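import Literature.AlgebraicGeometry.Hu2025.Proofs.S01S09Interface.PrintedSettingRatEmpty
import Literature.AlgebraicGeometry.Hu2025.Proofs.S01S09Interface.GammaQuadHu22Setup
import HarnessLib

/-!
# [Hu22] p.131 printed setting at `𝔽 = ℚ`: the literal printed record `Hu22Setup_printed L ℚ 9 d_quad` (row 110 file g) of
# the complete-quadrilateral family has NO inhabitant, for every `L` — instance of `PrintedSettingRatEmpty` at
# res-type-009's realised family (`S_quad`, p521626). OURS; nothing of the sources asserted.

**HONEST FRAMING (D-0012/D-0089).** [Hu2025]/[Hu2022] are unrefereed preprints under adjudication. This file combines two tree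
facts about OUR typed records: `Hu22Setup_printed.isEmpty_of_prop91Locus_nonempty` (res-type-024: at `𝔽 = ℚ` the literal
Spec-`ℤ` clause empties the record as soon as the Prop-9.1 locus of `Z_{Γ_d}/ℚ` is nonempty) and res-type-009's inhabitant
`S_quad : Hu22Setup_ours ℚ 9 quadHuMatroid` (whose `cell` is the nonempty integral Prop-9.1 locus, `range_cellToGamma`). Hence
the (β) reading over the LITERAL carrier is vacuous for `d_quad` at `ℚ`; the non-vacuous carrier is file h
(`Hu22Setup_printed_ours`). No verdict word is implied. AI proof is weaker than expert review.
-/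

noncomputable section

open CategoryTheory AlgebraicGeometry

namespace Literature.AlgebraicGeometry.Hu2025.Statements.S01S09Interface

open S08MainTheorem S07GammaSchemes S03Pluecker

/-- **The Prop-9.1 locus of `Z_{Γ_d}/ℚ` for the complete quadrilateral is nonempty** (it is the image of res-type-009's
integral, hence nonempty, cell `S_quad.cell`). [cite: Hu2025, Prop. 9.1 (chunk p0072 l.71–82) with [Hu22] p.131 l.27–28; joint J1 = GAP-LEDGER-HU row HU-R01 (unrefereed preprints arXiv:2203.03842v4 / arXiv:2507.21400v1 under adjudication, D-0012/D-0089 — kernel statement about OUR typed records of row 110; nothing of the sources asserted)] -/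
theorem prop91Locus_quad_nonempty :
    {x : PrimeSpectrum (GammaSchemeRing (primaryFamily 9 ℚ) (GammaOfMatroidVar quadHuMatroid)) |
      ∀ u : plVar 9, u ∉ GammaOfMatroidVar quadHuMatroid →
        (Ideal.Quotient.mk (gammaWpIdeal (primaryFamily 9 ℚ) (GammaOfMatroidVar quadHuMatroid)) (MvPolynomial.X u)) ∉
          x.asIdeal}.Nonempty := by
  rw [← S_quad.range_cellToGamma]
  haveI : IsIntegral S_quad.cell := inferInstanceAs (IsIntegral Lit.cellScheme)
  exact Set.range_nonempty _

/-- **For the complete-quadrilateral family at `𝔽 = ℚ`, the literal printed record of [Hu22] p.131 (file g) has NO inhabitant,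
whatever the [La03] datum `L`.** Hence `Hu22P131L40_printed` is vacuously true there (cf. `hu22P131L40_printed_rat`), while
`Hu22P131L40` / `Hu22P131L40_ours` are refuted at `S_quad` (p521626) — typed-record facts for the J1 (β)/(α)/(γ) cells; no
verdict on the printed sentence. [cite: Hu2022, p.131 l.4–41 with Thm 9.4 p.130 l.39–50; joint J1 = GAP-LEDGER-HU row HU-R01 (unrefereed preprints arXiv:2203.03842v4 / arXiv:2507.21400v1 under adjudication, D-0012/D-0089 — kernel statement about OUR typed records of row 110; nothing of the sources asserted)] -/
theorem isEmpty_Hu22Setup_printed_quad (L : LafforgueObjects) : IsEmpty (Hu22Setup_printed L ℚ 9 quadHuMatroid) :=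
  Hu22Setup_printed.isEmpty_of_prop91Locus_nonempty prop91Locus_quad_nonempty

end Literature.AlgebraicGeometry.Hu2025.Statements.S01S09Interface

end
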